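import Summits.NavierStokesRegularity.NavierStokesRegularity.Theses.AxisymmetricExtremality
import Summits.NavierStokesRegularity.NavierStokesRegularity.Theorems.AxisymmetricExtremalityAxisymmetricKatoGlobalStubSereginLogSwirlOriginCFZBounds
import Summits.NavierStokesRegularity.NavierStokesRegularity.Theorems.AxisymmetricExtremalityAxisymmetricKatoGlobalStubSereginLogSwirlOriginStep3CutoffCalculus
import Literature.Analysis.FluidPDE.AxisymQuotientEquationsJ
import HarnessLib

/-!
# Seregin 2022, §2 Step 3: the localised (`η⁶`-weighted) energy inequalities of `Γ = ω_θ/r` and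
# `Φ = ω_r/r` at a fixed time, with the axis terms — crux stmt-NavierStokesRegularity-15453
# (`AxisymmetricExtremality.AxisymmetricKatoGlobal`), line registered, support for stub `stub_sereginLogSwirlOrigin`

Support file (`--supports stmt-NavierStokesRegularity-15453`; theorems only, everything proved)
toward the registered stub `stub_sereginLogSwirlOrigin` = the named fact
`Literature.Analysis.FluidPDE.seregin2022_logSwirl_regularAtOrigin` (G. Seregin, J. Math. Fluid
Mech. 24 (2022), Paper 27 = arXiv:2201.00153, §2). Step 3 ("Local estimates of solutions",
arXiv p. 6): the functions `Φ = ω_r/r = −v_{θ,3}/r` and `Γ = ω_θ/r` satisfy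
`∂ₜΦ + (v − 2x'/|x'|²)·∇Φ − ΔΦ + ω·∇(v_r/r) = 0`, `∂ₜΓ + (v − 2x'/|x'|²)·∇Γ − ΔΓ + 2(v_θ/r)Φ = 0`
(tree: `IsClassicalNSSolutionOn.radVelQuot_curl_eq`, `.angVortQuot_eq`, whole space, with the
smooth quotient `2 radDerivQuot G = (2x'/|x'|²)·∇G`); "multiply the first equation by `Φη⁶` and
the second by `Γη⁶`. After integration by parts, we find
`½∂ₜ∫(Φη³)² + ∫(η³|∇Φ|)² + π∫(η³Φ)²|_{x'=0}dx₃ = A₁ + A₂ + A₃`,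
`½∂ₜ∫(Γη³)² + ∫(η³|∇Γ|)² + π∫(η³Γ)²|_{x'=0}dx₃ = B₁ + B₂ + B₃`" with `A₁, B₁` the
`∂ₜη⁶ + Δη⁶` terms, `A₂, B₂` the `(v − 2x'/|x'|²)·∇η⁶` terms, `B₃ = −2∫(v_θ/r)Φη⁶Γ` and `A₃` the
`ω·∇(v_r/r)` term.

This file proves the honest fixed-time form of these two identities for a CLASSICAL axisymmetric
solution on a time set `S` (no decay at infinity: the cut-off `ζ = η³ ∈ C²_c` is compactly
supported and axisymmetric), in the `η³G`-form consumed by Step 4 (`|η³Φ|²_{2,Q} + |η³Γ|²_{2,Q}`):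

* `integral_cutoff_energy_eq` — for ANY `G ∈ C²` with `G' + DG[b] = ν(ΔG + 2q_G) + R`
  (`q_G = radDerivQuot G`), `b ∈ C¹` divergence free:
  `∫ ζ²G G' + ν∫|∇(ζG)|² = 2ν∫ζ²G q_G + ∫ζG² Dζ[b] + ν∫G²|∇ζ|² + ∫ζ²G R`;
* `integral_cutoff_energy_le` — if `ζ, G` are axisymmetric and `ν ≥ 0`: the axis term
  `2ν∫ζ²G q_G = 2ν∫(ζG)q_{ζG} − 2ν∫ζG²q_ζ` has `∫(ζG)q_{ζG} = −π∫(ζG)(0,0,z)²dz ≤ 0`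
  (`IsAxisymmetricScalar.integral_mul_radDerivQuot_nonpos`; this is the paper's
  `+π∫(η³G)²|_{x'=0}dx₃` on the left, with the GOOD sign for BOTH `Φ` and `Γ`), whence
  `∫ ζ²G G' + ν∫|∇(ζG)|² ≤ ∫ζG² Dζ[b] + ν∫G²|∇ζ|² − 2ν∫ζG² q_ζ + ∫ζ²G R`;
* `angVortQuot_cutoff_energy_le` (registered sub-goal) — **the `Γ`-inequality**: along a
  classical solution, `G = Γ = angVortQuot (v t)`, `G' = angVortQuot (∂ₜv t)`,
  `R = −2 (v_θ/r) Φ`, `v_θ/r = angVelQuot (v t)`, `Φ = radVelQuot (curl (v t))`: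
  `∫ζ²ΓΓ' + ν∫|∇(ζΓ)|² ≤ ∫ζΓ²Dζ[v] + ν∫Γ²|∇ζ|² − 2ν∫ζΓ²q_ζ − 2∫ζ²Γ(v_θ/r)Φ` (`B₁+B₂`, `B₃`);
* `radVelQuot_curl_cutoff_energy_le` (registered sub-goal) — **the `Φ`-inequality**:
  `G = Φ = radVelQuot (curl (v t))`, `R = D(v_r/r)[ω]`:
  `∫ζ²ΦΦ' + ν∫|∇(ζΦ)|² ≤ ∫ζΦ²Dζ[v] + ν∫Φ²|∇ζ|² − 2ν∫ζΦ²q_ζ + ∫ζ²Φ D(v_r/r)[ω]` (`A₁+A₂`, `A₃`).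

Here `∫ζ²GG' = ½ d/dt∫(ζG)² − ∫ζ(∂ₜζ)G²` once `ζ` depends on time (sequel file); the three cut-off
terms are supported on `supp ∇ζ` and are the paper's `A₁ + A₂`, `B₁ + B₂` (up to its factors);
the sources `B₃`, `A₃` are estimated in Step 3 with Lemma 2.2 (`seregin2022_lemma22`) and
Lemma 2.1. The cut-off calculus (`∫ζ²GΔG = ∫G²|∇ζ|² − ∫|∇(ζG)|²`, `∫ζ²G DG[b] = −∫ζG²Dζ[b]`,
`q_{ζG} = ζq_G + Gq_ζ`) is the sibling file `…Step3CutoffCalculus`.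

## Mathlib / tree search

Tree: `IsClassicalNSSolutionOn.angVortQuot_eq` (`AxisymQuotientEquationsOmega`),
`IsClassicalNSSolutionOn.radVelQuot_curl_eq` (`AxisymQuotientEquationsJ`),
`IsAxisymmetricScalar.integral_mul_radDerivQuot_nonpos` (`HouLeiLiEstimate`),
`integral_energy_eq_of_drift_laplacian`, `IsClassicalNSSolutionOn.angVortQuot_energy_le`
(`AxisymOmegaEnergy`, the GLOBAL identity under `L²` hypotheses and bounded drift — not usable on
a slab), `IsClassicalNSSolutionOn.integral_sqBallCutoff_mul_swirl_le` (`AxisymSwirlCutoffEnergy`,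
the analogous ball-cut-off scheme for the swirl `rv_θ`), `hasCompactSupport_radDerivQuot`
(`…CFZBounds`), `integral_sq_mul_mul_laplacian`, `integral_sq_mul_mul_fderiv_apply`,
`radDerivQuot_mul` (`…Step3CutoffCalculus`), `contDiff_angVortQuot / angVelQuot / radVelQuot`,
`IsAxisymmetric.isAxisymmetricScalar_angVortQuot / radVelQuot`, `IsAxisymmetric.curl`.
`lean search 'cutoff_energy|angVortQuot_cutoff|radVelQuot_curl_cutoff'`: no matches (2026-08-17).

## References

* G. Seregin, J. Math. Fluid Mech. 24 (2022), Paper No. 27 = arXiv:2201.00153, §2 Step 3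
  (arXiv p. 6, the two displayed identities with `A₁, A₂, A₃`, `B₁, B₂, B₃`).
  [`Seregin2022LocalAxisym`]
* Z. Lei, Q. S. Zhang, Pacific J. Math. 289 (2017) = arXiv:1505.02628, §3 (the global versions,
  axis boundary terms). [`LeiZhang2017`]
-/

noncomputable section

open MeasureTheory Set Filter Topology Function
open scoped ENNReal ContDiff Laplacian
open Literature.Analysis.FluidPDE

-- `<Problem> = <Summit>` duplicates a namespace component by design (lakefile sets the same option).
set_option linter.dupNamespace false

namespace Summit.NavierStokesRegularity.NavierStokesRegularity.Theorems.AxisymmetricKatoGlobal.EulerScaling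

/-! ### The localised energy identity and inequality for a drift–Laplace equation with axis term -/

section Energy

variable {G G' R ζ : EuclideanSpace ℝ (Fin 3) → ℝ} {b : EuclideanSpace ℝ (Fin 3) → EuclideanSpace ℝ (Fin 3)}
  {ν : ℝ}

/-- **Localised energy identity** (the computation of Seregin 2022, §2 Step 3, "multiply the
equation by `Γη⁶` and integrate by parts", for a general scalar). Let `G ∈ C²(ℝ³)` satisfy
pointwise `G' + DG[b] = ν (ΔG + 2 q_G) + R` (`q_G = radDerivQuot G = (∂ᵣG)/r`, so
`2q_G = (2x'/|x'|²)·∇G`), with `b ∈ C¹` divergence free and `R` continuous, and let `ζ ∈ C¹` have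
compact support (`ζ = η³`). Then, with no integrability assumption on `G`,
`∫ ζ²G G' + ν ∫ |∇(ζG)|² = 2ν ∫ ζ²G q_G + ∫ ζG² Dζ[b] + ν ∫ G²|∇ζ|² + ∫ ζ²G R`.
[cite: Seregin2022LocalAxisym, §2 Step 3 (arXiv:2201.00153 p. 6, the identities for Φη⁶ and Γη⁶)] -/
theorem integral_cutoff_energy_eq (hG : ContDiff ℝ 2 G) (hζ : ContDiff ℝ 1 ζ)
    (hζc : HasCompactSupport ζ) (hR : Continuous R) (hb : ContDiff ℝ 1 b)
    (hdiv : VectorCalculus.IsDivFree b)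
    (heq : ∀ x, G' x + fderiv ℝ G x (b x) = ν * ((Δ G) x + 2 * radDerivQuot G x) + R x) :
    (∫ x, ζ x ^ 2 * G x * G' x) +
      ν * ∫ x, (fderiv ℝ (fun y => ζ y * G y) x (EuclideanSpace.single 0 1) ^ 2 +
        fderiv ℝ (fun y => ζ y * G y) x (EuclideanSpace.single 1 1) ^ 2 +
        fderiv ℝ (fun y => ζ y * G y) x (EuclideanSpace.single 2 1) ^ 2) =
      2 * ν * (∫ x, ζ x ^ 2 * G x * radDerivQuot G x) +
      (∫ x, ζ x * G x ^ 2 * fderiv ℝ ζ x (b x)) +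
      ν * (∫ x, G x ^ 2 * (fderiv ℝ ζ x (EuclideanSpace.single 0 1) ^ 2 +
        fderiv ℝ ζ x (EuclideanSpace.single 1 1) ^ 2 + fderiv ℝ ζ x (EuclideanSpace.single 2 1) ^ 2)) +
      ∫ x, ζ x ^ 2 * G x * R x := by
  have hG1 : ContDiff ℝ 1 G := hG.of_le (by norm_num)
  have hT := integral_sq_mul_mul_fderiv_apply ζ G b hζ hζc hG1 hb hdiv
  have hL := integral_sq_mul_mul_laplacian hζ hζc hG
  -- integrability of the four pieces
  have iT : Integrable (fun x => ζ x ^ 2 * G x * fderiv ℝ G x (b x)) :=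
    integrable_sq_mul_mul hζ.continuous hζc hG.continuous
      ((hG.continuous_fderiv two_ne_zero).clm_apply hb.continuous)
  have iL : Integrable (fun x => ζ x ^ 2 * G x * (Δ G) x) :=
    integrable_sq_mul_mul hζ.continuous hζc hG.continuous (continuous_laplacian hG)
  have iQ : Integrable (fun x => ζ x ^ 2 * G x * radDerivQuot G x) :=
    integrable_sq_mul_mul hζ.continuous hζc hG.continuous (continuous_radDerivQuot hG)
  have iR : Integrable (fun x => ζ x ^ 2 * G x * R x) :=
    integrable_sq_mul_mul hζ.continuous hζc hG.continuous hR
  have hpt : ∀ x, ζ x ^ 2 * G x * G' x =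
      -(ζ x ^ 2 * G x * fderiv ℝ G x (b x)) + ν * (ζ x ^ 2 * G x * (Δ G) x) +
        2 * ν * (ζ x ^ 2 * G x * radDerivQuot G x) + ζ x ^ 2 * G x * R x := by
    intro x
    have h := heq x
    have : G' x = -fderiv ℝ G x (b x) + ν * ((Δ G) x + 2 * radDerivQuot G x) + R x := by linarith
    rw [this]
    ring
  have iTn : Integrable (fun x => -(ζ x ^ 2 * G x * fderiv ℝ G x (b x))) := iT.neg
  have iLν : Integrable (fun x => ν * (ζ x ^ 2 * G x * (Δ G) x)) := iL.const_mul ν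
  have iQν : Integrable (fun x => 2 * ν * (ζ x ^ 2 * G x * radDerivQuot G x)) :=
    iQ.const_mul (2 * ν)
  have i12 : Integrable (fun x => -(ζ x ^ 2 * G x * fderiv ℝ G x (b x)) +
      ν * (ζ x ^ 2 * G x * (Δ G) x)) := iTn.add iLν
  have i123 : Integrable (fun x => -(ζ x ^ 2 * G x * fderiv ℝ G x (b x)) +
      ν * (ζ x ^ 2 * G x * (Δ G) x) + 2 * ν * (ζ x ^ 2 * G x * radDerivQuot G x)) :=
    i12.add iQν
  have hint : ∫ x, ζ x ^ 2 * G x * G' x =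
      -(∫ x, ζ x ^ 2 * G x * fderiv ℝ G x (b x)) + ν * (∫ x, ζ x ^ 2 * G x * (Δ G) x) +
        2 * ν * (∫ x, ζ x ^ 2 * G x * radDerivQuot G x) + ∫ x, ζ x ^ 2 * G x * R x := by
    rw [integral_congr_ae (Eventually.of_forall hpt), integral_add i123 iR, integral_add i12 iQν,
      integral_add iTn iLν, integral_neg, integral_const_mul, integral_const_mul]
  rw [hint, hT, hL]
  ring

/-- **Localised energy inequality with the axis term dropped** (Seregin 2022, §2 Step 3: the
boundary terms `π∫(η³Φ)²|_{x'=0}dx₃`, `π∫(η³Γ)²|_{x'=0}dx₃` have the good sign and are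
discarded). Under the hypotheses of `integral_cutoff_energy_eq`, if moreover `ζ, G ∈ C²` are
axisymmetric and `ν ≥ 0`, then `2ν∫ζ²G q_G = 2ν∫(ζG) q_{ζG} − 2ν∫ζG² q_ζ` with
`∫ (ζG) q_{ζG} = −π ∫ (ζG)(0,0,z)² dz ≤ 0` (`IsAxisymmetricScalar.integral_mul_radDerivQuot_nonpos`),
whence
`∫ ζ²G G' + ν ∫ |∇(ζG)|² ≤ ∫ ζG² Dζ[b] + ν ∫ G²|∇ζ|² − 2ν ∫ ζG² q_ζ + ∫ ζ²G R`:
all terms on the right are supported on `supp ∇ζ` except the source `∫ ζ²G R`.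
[cite: Seregin2022LocalAxisym, §2 Step 3 (arXiv:2201.00153 p. 6, the identities for Φη⁶ and Γη⁶)] -/
theorem integral_cutoff_energy_le (hG : ContDiff ℝ 2 G) (hGax : IsAxisymmetricScalar G)
    (hζ : ContDiff ℝ 2 ζ) (hζax : IsAxisymmetricScalar ζ) (hζc : HasCompactSupport ζ)
    (hν : 0 ≤ ν) (hR : Continuous R) (hb : ContDiff ℝ 1 b) (hdiv : VectorCalculus.IsDivFree b)
    (heq : ∀ x, G' x + fderiv ℝ G x (b x) = ν * ((Δ G) x + 2 * radDerivQuot G x) + R x) :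
    (∫ x, ζ x ^ 2 * G x * G' x) +
      ν * ∫ x, (fderiv ℝ (fun y => ζ y * G y) x (EuclideanSpace.single 0 1) ^ 2 +
        fderiv ℝ (fun y => ζ y * G y) x (EuclideanSpace.single 1 1) ^ 2 +
        fderiv ℝ (fun y => ζ y * G y) x (EuclideanSpace.single 2 1) ^ 2) ≤
      (∫ x, ζ x * G x ^ 2 * fderiv ℝ ζ x (b x)) +
      ν * (∫ x, G x ^ 2 * (fderiv ℝ ζ x (EuclideanSpace.single 0 1) ^ 2 +
        fderiv ℝ ζ x (EuclideanSpace.single 1 1) ^ 2 + fderiv ℝ ζ x (EuclideanSpace.single 2 1) ^ 2)) -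
      2 * ν * (∫ x, ζ x * G x ^ 2 * radDerivQuot ζ x) +
      ∫ x, ζ x ^ 2 * G x * R x := by
  have hζ1 : ContDiff ℝ 1 ζ := hζ.of_le (by norm_num)
  have hid := integral_cutoff_energy_eq hG hζ1 hζc hR hb hdiv heq
  -- the axis term: `∫ ζ²G q_G = ∫ H q_H - ∫ ζG² q_ζ`, `H = ζG`, and `∫ H q_H ≤ 0`
  have hP : ContDiff ℝ 2 fun y => ζ y * G y := hζ.mul hG
  have hPax : IsAxisymmetricScalar fun y => ζ y * G y := hζax.mul hGax
  have hPc : HasCompactSupport fun y => ζ y * G y := hζc.mul_right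
  have hH : MemLp (fun y => ζ y * G y) 2 volume := hP.continuous.memLp_of_hasCompactSupport hPc
  have hq : MemLp (radDerivQuot fun y => ζ y * G y) 2 volume :=
    (continuous_radDerivQuot hP).memLp_of_hasCompactSupport (hasCompactSupport_radDerivQuot hP hPax hPc)
  have hax := hPax.integral_mul_radDerivQuot_nonpos hP hH hq
  have iQ : Integrable (fun x => ζ x ^ 2 * G x * radDerivQuot G x) :=
    integrable_sq_mul_mul hζ.continuous hζc hG.continuous (continuous_radDerivQuot hG)
  have iZ : Integrable (fun x => ζ x * G x ^ 2 * radDerivQuot ζ x) :=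
    ((hζ.continuous.mul (hG.continuous.pow 2)).mul (continuous_radDerivQuot hζ)).integrable_of_hasCompactSupport
      (hζc.mul_right).mul_right
  have hsplit : ∫ x, (ζ x * G x) * radDerivQuot (fun y => ζ y * G y) x =
      (∫ x, ζ x ^ 2 * G x * radDerivQuot G x) + ∫ x, ζ x * G x ^ 2 * radDerivQuot ζ x := by
    rw [← integral_add iQ iZ]
    refine integral_congr_ae (Eventually.of_forall fun x => ?_)
    beta_reduce
    rw [radDerivQuot_mul ζ G hζ hG hζax hGax x]
    ring
  have hsign : 2 * ν * ((∫ x, ζ x ^ 2 * G x * radDerivQuot G x) +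
      ∫ x, ζ x * G x ^ 2 * radDerivQuot ζ x) ≤ 0 := by
    rw [← hsplit]
    exact mul_nonpos_of_nonneg_of_nonpos (by positivity) hax
  nlinarith [hid, hsign]

end Energy

/-! ### Seregin's `Γ = ω_θ/r` and `Φ = ω_r/r` along a classical axisymmetric solution -/

section NavierStokes

variable {S : Set ℝ} {ν : ℝ} {v : ℝ → EuclideanSpace ℝ (Fin 3) → EuclideanSpace ℝ (Fin 3)}
  {q : ℝ → EuclideanSpace ℝ (Fin 3) → ℝ} {ζ : EuclideanSpace ℝ (Fin 3) → ℝ}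

/-- **Seregin 2022, §2 Step 3, the localised energy inequality for `Γ = ω_θ/r`** (fixed time,
classical form). For a classical solution of the unforced Navier–Stokes system with viscosity
`ν ≥ 0` on a time set `S ⊆ closure (interior S)` of unique differentiability with axisymmetric
velocity, `t ∈ S`, and an axisymmetric cut-off `ζ ∈ C²` with compact support (`ζ = η³`): with
`Γ = angVortQuot (v t)`, `Γ' = angVortQuot (∂ₜv t)`, `v_θ/r = angVelQuot (v t)`,
`Φ = ω_r/r = radVelQuot (curl (v t))` (the equation
`∂ₜΓ + (v − 2x'/|x'|²)·∇Γ − νΔΓ + 2(v_θ/r)Φ = 0`, `IsClassicalNSSolutionOn.angVortQuot_eq`),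
`∫ ζ²Γ Γ' + ν∫|∇(ζΓ)|² ≤ ∫ ζΓ² Dζ[v] + ν∫ Γ²|∇ζ|² − 2ν∫ ζΓ² q_ζ − 2∫ ζ²Γ (v_θ/r) Φ`
(the axis term `2π∫(ζΓ)²|_{r=0}dx₃ ≥ 0` dropped; `B₁, B₂` = the three cut-off terms, `B₃` = the
last). [cite: Seregin2022LocalAxisym, §2 Step 3 (arXiv:2201.00153 p. 6, the identity for Γη⁶ with B₁, B₂, B₃)] -/
theorem angVortQuot_cutoff_energy_le : ∀ (S : Set ℝ) (ν : ℝ) (v : ℝ → EuclideanSpace ℝ (Fin 3) → EuclideanSpace ℝ (Fin 3)) (q : ℝ → EuclideanSpace ℝ (Fin 3) → ℝ) (ζ : EuclideanSpace ℝ (Fin 3) → ℝ) (t : ℝ), IsClassicalNSSolutionOn S ν 0 v q → UniqueDiffOn ℝ S → S ⊆ closure (interior S) → (∀ s ∈ S, IsAxisymmetric (v s)) → 0 ≤ ν → t ∈ S → ContDiff ℝ 2 ζ → IsAxisymmetricScalar ζ → HasCompactSupport ζ → (∫ x, ζ x ^ 2 * angVortQuot (v t) x * angVortQuot (timeDerivWithin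 S v t) x) + ν * ∫ x, (fderiv ℝ (fun y => ζ y * angVortQuot (v t) y) x (EuclideanSpace.single 0 1) ^ 2 + fderiv ℝ (fun y => ζ y * angVortQuot (v t) y) x (EuclideanSpace.single 1 1) ^ 2 + fderiv ℝ (fun y => ζ y * angVortQuot (v t) y) x (EuclideanSpace.single 2 1) ^ 2) ≤ (∫ x, ζ x * angVortQuot (v t) x ^ 2 * fderiv ℝ ζ x (v t x)) + ν * (∫ x, angVortQuot (v t) x ^ 2 * (fderiv ℝ ζ x (EuclideanSpace.single 0 1) ^ 2 + fderiv ℝ ζ x (EuclideanSpace.single 1 1) ^ 2 + fderiv ℝ ζ x (EuclideanSpace.single 2 1) ^ 2)) - 2 * ν * (∫ x, ζ x * angVortQuot (v t) x ^ 2 * radDerivQuot ζ x) - 2 * ∫ x, ζ x ^ 2 * angVortQuot (v t) x * (angVelQuot (v t) x * radVelQuot (curl (v t)) x) := by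
  intro S ν v q ζ t hns hS hcl hax hν ht hζ hζax hζc
  have hv : ContDiff ℝ ∞ (v t) := hns.contDiff_velocity ht
  have hv1 : ContDiff ℝ 1 (v t) := hv.of_le (by norm_cast)
  have hv3 : ContDiff ℝ 3 (v t) := hv.of_le (by norm_cast)
  have hv4 : ContDiff ℝ 4 (v t) := hv.of_le (by norm_cast)
  have hv5 : ContDiff ℝ 5 (v t) := hv.of_le (by norm_cast)
  have hω : ContDiff ℝ ∞ (curl (v t)) := by
    rw [curl_eq_curlCLM_comp]
    exact curlCLM.contDiff.comp (hv.fderiv_right (m := ∞) (by simp))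
  have hω4 : ContDiff ℝ 4 (curl (v t)) := hω.of_le (by norm_cast)
  have hΩ2 : ContDiff ℝ 2 (angVortQuot (v t)) := contDiff_angVortQuot (n := 2) hv5
  have hΩax : IsAxisymmetricScalar (angVortQuot (v t)) :=
    (hax t ht).isAxisymmetricScalar_angVortQuot hv3
  have hΦ : ContDiff ℝ 2 (angVelQuot (v t)) := contDiff_angVelQuot (n := 2) hv4
  have hJ : ContDiff ℝ 2 (radVelQuot (curl (v t))) := contDiff_radVelQuot (n := 2) hω4
  have hR : Continuous fun x => (-2) * (angVelQuot (v t) x * radVelQuot (curl (v t)) x) :=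
    continuous_const.mul (hΦ.continuous.mul hJ.continuous)
  have heq : ∀ x, angVortQuot (timeDerivWithin S v t) x + fderiv ℝ (angVortQuot (v t)) x (v t x) =
      ν * ((Δ (angVortQuot (v t))) x + 2 * radDerivQuot (angVortQuot (v t)) x) +
        (-2) * (angVelQuot (v t) x * radVelQuot (curl (v t)) x) := fun x => by
    rw [hns.angVortQuot_eq hS hcl hax ht x]
    ring
  have h := integral_cutoff_energy_le hΩ2 hΩax hζ hζax hζc hν hR hv1 (hns.divFree t ht) heq
  have hrw : ∫ x, ζ x ^ 2 * angVortQuot (v t) x *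
      ((-2) * (angVelQuot (v t) x * radVelQuot (curl (v t)) x)) =
      -2 * ∫ x, ζ x ^ 2 * angVortQuot (v t) x *
        (angVelQuot (v t) x * radVelQuot (curl (v t)) x) := by
    rw [← integral_const_mul]
    exact integral_congr_ae (Eventually.of_forall fun x => by ring)
  rw [hrw] at h
  linarith

/-- **Seregin 2022, §2 Step 3, the localised energy inequality for `Φ = ω_r/r`** (fixed time,
classical form). Same setting as `angVortQuot_cutoff_energy_le`; with `Φ = radVelQuot (curl (v t))`,
`Φ' = radVelQuot (curl (∂ₜv t))`, `v_r/r = radVelQuot (v t)`, `ω = curl (v t)` (the equation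
`∂ₜΦ + (v − 2x'/|x'|²)·∇Φ − νΔΦ − ω·∇(v_r/r) = 0`, `IsClassicalNSSolutionOn.radVelQuot_curl_eq`,
`ω·∇(v_r/r) = (ω_r∂_r + ω₃∂₃)(v_r/r)`),
`∫ ζ²Φ Φ' + ν∫|∇(ζΦ)|² ≤ ∫ ζΦ² Dζ[v] + ν∫ Φ²|∇ζ|² − 2ν∫ ζΦ² q_ζ + ∫ ζ²Φ D(v_r/r)[ω]`
(the axis term `2π∫(ζΦ)²|_{r=0}dx₃ ≥ 0` dropped; `A₁, A₂` = the three cut-off terms, `A₃` = the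
last). [cite: Seregin2022LocalAxisym, §2 Step 3 (arXiv:2201.00153 p. 6, the identity for Φη⁶ with A₁, A₂, A₃)] -/
theorem radVelQuot_curl_cutoff_energy_le : ∀ (S : Set ℝ) (ν : ℝ) (v : ℝ → EuclideanSpace ℝ (Fin 3) → EuclideanSpace ℝ (Fin 3)) (q : ℝ → EuclideanSpace ℝ (Fin 3) → ℝ) (ζ : EuclideanSpace ℝ (Fin 3) → ℝ) (t : ℝ), IsClassicalNSSolutionOn S ν 0 v q → UniqueDiffOn ℝ S → S ⊆ closure (interior S) → (∀ s ∈ S, IsAxisymmetric (v s)) → 0 ≤ ν → t ∈ S → ContDiff ℝ 2 ζ → IsAxisymmetricScalar ζ → HasCompactSupport ζ → (∫ x, ζ x ^ 2 * radVelQuot (curl (v t)) x * radVelQuot (curl (timeDerivWithin S v t)) x) + ν * ∫ x, (fderiv ℝ (fun y => ζ y * radVelQuot (curl (v t)) y) x (EuclideanSpace.single 0 1) ^ 2 + fderiv ℝ (fun y => ζ y * radVelQuot (curl (v t)) y) x (EuclideanSpace.single 1 1) ^ 2 + fderiv ℝ (fun y => ζ y * radVelQuot (curl (v t)) y) x (EuclideanSpace.single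 2 1) ^ 2) ≤ (∫ x, ζ x * radVelQuot (curl (v t)) x ^ 2 * fderiv ℝ ζ x (v t x)) + ν * (∫ x, radVelQuot (curl (v t)) x ^ 2 * (fderiv ℝ ζ x (EuclideanSpace.single 0 1) ^ 2 + fderiv ℝ ζ x (EuclideanSpace.single 1 1) ^ 2 + fderiv ℝ ζ x (EuclideanSpace.single 2 1) ^ 2)) - 2 * ν * (∫ x, ζ x * radVelQuot (curl (v t)) x ^ 2 * radDerivQuot ζ x) + ∫ x, ζ x ^ 2 * radVelQuot (curl (v t)) x * fderiv ℝ (radVelQuot (v t)) x (curl (v t) x) := by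
  intro S ν v q ζ t hns hS hcl hax hν ht hζ hζax hζc
  have hv : ContDiff ℝ ∞ (v t) := hns.contDiff_velocity ht
  have hv1 : ContDiff ℝ 1 (v t) := hv.of_le (by norm_cast)
  have hv3 : ContDiff ℝ 3 (v t) := hv.of_le (by norm_cast)
  have hvd : Differentiable ℝ (v t) := hv.differentiable (by simp)
  have hω : ContDiff ℝ ∞ (curl (v t)) := by
    rw [curl_eq_curlCLM_comp]
    exact curlCLM.contDiff.comp (hv.fderiv_right (m := ∞) (by simp))
  have hω2 : ContDiff ℝ 2 (curl (v t)) := hω.of_le (by norm_cast)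
  have hω4 : ContDiff ℝ 4 (curl (v t)) := hω.of_le (by norm_cast)
  have haxω : IsAxisymmetric (curl (v t)) := (hax t ht).curl hvd
  have hJ2 : ContDiff ℝ 2 (radVelQuot (curl (v t))) := contDiff_radVelQuot (n := 2) hω4
  have hJax : IsAxisymmetricScalar (radVelQuot (curl (v t))) :=
    haxω.isAxisymmetricScalar_radVelQuot hω2
  have hW : ContDiff ℝ 1 (radVelQuot (v t)) := contDiff_radVelQuot (n := 1) hv3
  have hR : Continuous fun x => fderiv ℝ (radVelQuot (v t)) x (curl (v t) x) :=
    (hW.continuous_fderiv one_ne_zero).clm_apply hω.continuous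
  exact integral_cutoff_energy_le hJ2 hJax hζ hζax hζc hν hR hv1 (hns.divFree t ht)
    (hns.radVelQuot_curl_eq hS hcl hax ht)

end NavierStokes

end Summit.NavierStokesRegularity.NavierStokesRegularity.Theorems.AxisymmetricKatoGlobal.EulerScaling

end
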